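import Mathlib
import Summits.ValiantsHypothesis.ValiantsHypothesis.Theorems.RigidityForcesSymmetryRankRigidMinimalReprLaplaceRestrict

/-!
# Rectangular contraction: a full-support covector turns a decomposition of `P₅` into one of the `4 × 5` injective pattern
# (crux `RankRigidMinimalRepr`, stmt-ValiantsHypothesis-18034; frontier rung `LaplaceOptimalFive`, stmt-24813)

p8 g11's `…LaplaceContract.lean` contracts one slot `i` of a split-rank-one decomposition of `P_{d+1}` against a covector
`λ` and then RESTRICTS the other slots to the letters `≠ a` (`λ_a ≠ 0`), landing in the square format of
`LaplaceOptimal d`.  That restriction forgets the fifth letter, and with it exactly the information that separates the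
pair-heavy CORE of `LaplaceOptimal 5` (a ≤ 2 slices) from what `laplaceOptimal_four` can see: at `d + 1 = 5` the count
`24 ≤ 6·(…) + 4·(…)` of `contract_five` kills no profile with `a ≤ 1`.

Here the other slots keep ALL `d + 1` letters.  If every coordinate of `λ` is non-zero, then
`Σ_c λ_c [v[i ↦ c] injective] = λ_{m(v')} · [v' injective]` (`m(v')` the one letter missed by the injective
`v' : Fin d → Fin (d+1)`), and the torus identity `Π_k λ_{v' k} · λ_{m(v')} = Π_c λ_c` lets the weight `λ_{m(v')}` be
absorbed into the two factors of every term (`sum_pattern_rect`).  Hence (`contract_rect`) the contracted terms form a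
split-rank-one decomposition of the RECTANGULAR pattern `[v' : Fin d → Fin (d+1) injective]` across the restricted splits,
the killed terms dropping out, and ANY weighted lower bound for the rectangular pattern — entering as an explicit HYPOTHESIS
`hR` (weight function `wt`, bound `B`; nothing is asserted about it here) — bounds the surviving terms.

At `d + 1 = 5` the relevant rectangular statement is «LO(4,5)»: for the `4`-slot, `5`-letter injective pattern every
split-rank-one decomposition has `2·#slices + #pairs ≥ 10` (flattening ranks `5` and `C(5,2) = 10`; Laplace along one slot
or along two slots is tight).  Its PAIR half alone («the `4 × 5` injective pattern is not a sum of nine `2|2` terms»)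
gives, by `no_idle_slot_of_rect`, that a cheap slice-free decomposition of `P₅` uses EVERY slot on the pair side of some
term; the full statement gives (companion file `…LaplaceContractRectFive.lean`, `contract_five_rect`): for slices
`α_k(v_{i k}) W_k` and pairs `u_t(v_{p t}, v_{q t}) w_t`
summing to `P₅` and a slot `s` whose slice vectors are killed by a covector with all coordinates non-zero,
`10 ≤ 2·#{k : i k ≠ s} + 2·#{t : s ∈ {p t, q t}} + #{t : s ∉ {p t, q t}}`.  Census (this seat, memo on the item): given
LO(4,5) these two corollaries dispose of 342/350 (a = 2), 375/606 (a = 1) and 111/539 (a = 0, the idle-slot profiles —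
among them the numerically border-like `3·{01,02,12}`) maximal cheap profiles, up to letter-indicator slices.

No definitions.  HONEST FRAMING: a conditional transfer inside one route's frontier rung; LO(4,5) is NOT proved here (it is
a statement of exactly the shape of `laplaceOptimal_four`, one letter up); `LaplaceOptimalFive` (stmt-24813) stays OPEN;
nothing here bears on `VP ≠ VNP`.
-/

set_option autoImplicit false

-- the mandated summit-side namespace repeats a component by design (single-problem summit)
set_option linter.dupNamespace false

namespace Summit.ValiantsHypothesis.ValiantsHypothesis.Theorems.RigidityForcesSymmetryRankRigidMinimalRepr

namespace LaplaceContractRect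

open Finset

variable {d : ℕ}

/-! ### §1 The rectangular embedding: a free letter at the contracted slot, all letters elsewhere -/

/-- Injectivity of the embedded assignment: the small assignment is injective and misses the free letter. -/
theorem ins_injective_iff (i c : Fin (d + 1)) (v : Fin d → Fin (d + 1)) :
    Function.Injective (i.insertNth c v : Fin (d + 1) → Fin (d + 1)) ↔
      Function.Injective v ∧ c ∉ univ.image v := by
  constructor
  · intro h
    refine ⟨fun k k' hkk' => ?_, fun hc => ?_⟩
    · have h1 : (i.insertNth c v : Fin (d + 1) → Fin (d + 1)) (i.succAbove k) =
          (i.insertNth c v : Fin (d + 1) → Fin (d + 1)) (i.succAbove k') := by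
        rw [Fin.insertNth_apply_succAbove, Fin.insertNth_apply_succAbove, hkk']
      exact Fin.succAbove_right_injective (h h1)
    · obtain ⟨k, -, hk⟩ := mem_image.mp hc
      have h1 : (i.insertNth c v : Fin (d + 1) → Fin (d + 1)) (i.succAbove k) =
          (i.insertNth c v : Fin (d + 1) → Fin (d + 1)) i := by
        rw [Fin.insertNth_apply_succAbove, Fin.insertNth_apply_same, hk]
      exact Fin.succAbove_ne i k (h h1)
  · rintro ⟨hv, hc⟩ j j' hjj'
    rcases Fin.eq_self_or_eq_succAbove i j with hj | ⟨k, hk⟩ <;>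
      rcases Fin.eq_self_or_eq_succAbove i j' with hj' | ⟨k', hk'⟩
    · rw [hj, hj']
    · rw [hj, hk', Fin.insertNth_apply_same, Fin.insertNth_apply_succAbove] at hjj'
      exact absurd (mem_image.mpr ⟨k', mem_univ _, hjj'.symm⟩) hc
    · rw [hk, hj', Fin.insertNth_apply_succAbove, Fin.insertNth_apply_same] at hjj'
      exact absurd (mem_image.mpr ⟨k, mem_univ _, hjj'⟩) hc
    · rw [hk, hk', Fin.insertNth_apply_succAbove, Fin.insertNth_apply_succAbove] at hjj'
      rw [hk, hk', hv hjj']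

/-- **The torus identity of the rectangular contraction.**  For `λ : Fin (d+1) → ℂ` and `v : Fin d → Fin (d+1)`:
`(Π_k λ_{v k}) · Σ_c λ_c [v[i ↦ c] injective] = [v injective] · Π_c λ_c` — an injective `v` misses exactly one letter
`m`, the only free letter keeping the embedding injective, and `Π_k λ_{v k} · λ_m = Π_c λ_c`. -/
theorem sum_pattern_rect (i : Fin (d + 1)) (lam : Fin (d + 1) → ℂ) (v : Fin d → Fin (d + 1)) :
    (∏ k, lam (v k)) * (∑ c, lam c *
      (if Function.Injective (i.insertNth c v : Fin (d + 1) → Fin (d + 1)) then (1 : ℂ) else 0)) =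
      if Function.Injective v then ∏ c, lam c else 0 := by
  classical
  by_cases hv : Function.Injective v
  · rw [if_pos hv]
    -- the image and its one-letter complement
    have hcard : ((univ.image v)ᶜ).card = 1 := by
      rw [card_compl, card_image_of_injective _ hv, Fintype.card_fin, card_univ, Fintype.card_fin]
      omega
    obtain ⟨m, hm⟩ := card_eq_one.mp hcard
    have hsum : (∑ c, lam c * (if Function.Injective (i.insertNth c v : Fin (d + 1) → Fin (d + 1))
        then (1 : ℂ) else 0)) = lam m := by
      have : ∀ c, (lam c * if Function.Injective (i.insertNth c v : Fin (d + 1) → Fin (d + 1)) then (1 : ℂ) else 0)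
          = if c ∈ (univ.image v)ᶜ then lam c else 0 := by
        intro c
        by_cases hc : c ∈ (univ.image v)ᶜ
        · rw [if_pos hc, if_pos ((ins_injective_iff i c v).mpr ⟨hv, mem_compl.mp hc⟩), mul_one]
        · rw [if_neg hc, if_neg (fun h => hc (mem_compl.mpr ((ins_injective_iff i c v).mp h).2)), mul_zero]
      simp only [this]
      rw [← sum_filter, filter_mem_eq_inter, univ_inter, hm, sum_singleton]
    have hprod : (∏ k, lam (v k)) = ∏ c ∈ univ.image v, lam c := by
      rw [prod_image (fun k _ k' _ h => hv h)]
    rw [hsum, hprod, ← prod_mul_prod_compl (univ.image v) lam, hm, prod_singleton]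
  · rw [if_neg hv]
    have : ∀ c, (lam c * if Function.Injective (i.insertNth c v : Fin (d + 1) → Fin (d + 1)) then (1 : ℂ) else 0) = 0 :=
      fun c => by rw [if_neg (fun h => hv ((ins_injective_iff i c v).mp h).1), mul_zero]
    simp only [this, sum_const_zero, mul_zero]

/-! ### §2 Rectangular contraction of a decomposition -/

/-- **Rectangular contraction.**  A split-rank-one decomposition of `P_{d+1}` (official `LaplaceOptimal (d+1)` data), a
slot `i`, a covector `lam` with ALL coordinates non-zero, and a set `K ⊆ T` of terms killed by `lam` at slot `i` (a
`u`-factor with `i ∈ S_t` and `Σ_c lam_c u_t(v[i ↦ c]) ≡ 0`, or a `w`-factor with `i ∉ S_t` likewise).  Then every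
weighted bound `hR` for split-rank-one decompositions of the RECTANGULAR pattern `[v : Fin d → Fin (d+1) injective]`
(weight `wt |S|`, bound `B`) bounds the surviving terms: `B ≤ Σ_{t ∈ T \ K} wt c_t`, `c_t = |{k : i.succAbove k ∈ S_t}|`. -/
theorem contract_rect (wt : ℕ → ℕ) (B : ℕ)
    (hR : ∀ (N' : ℕ) (T' : Finset (Fin N')) (S' : Fin N' → Finset (Fin d))
      (u' w' : Fin N' → (Fin d → Fin (d + 1)) → ℂ),
      (∀ t, ∀ v v' : Fin d → Fin (d + 1), (∀ k ∈ S' t, v k = v' k) → u' t v = u' t v') →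
      (∀ t, ∀ v v' : Fin d → Fin (d + 1), (∀ k, k ∉ S' t → v k = v' k) → w' t v = w' t v') →
      (∀ v : Fin d → Fin (d + 1), (∑ t ∈ T', u' t v * w' t v) = if Function.Injective v then 1 else 0) →
      B ≤ ∑ t ∈ T', wt (S' t).card)
    {N : ℕ} (T : Finset (Fin N)) (S : Fin N → Finset (Fin (d + 1)))
    (u w : Fin N → (Fin (d + 1) → Fin (d + 1)) → ℂ)
    (hu : ∀ t, ∀ v v' : Fin (d + 1) → Fin (d + 1), (∀ j ∈ S t, v j = v' j) → u t v = u t v')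
    (hw : ∀ t, ∀ v v' : Fin (d + 1) → Fin (d + 1), (∀ j, j ∉ S t → v j = v' j) → w t v = w t v')
    (hsum : ∀ v : Fin (d + 1) → Fin (d + 1), (∑ t ∈ T, u t v * w t v) = if Function.Injective v then 1 else 0)
    (i : Fin (d + 1)) (lam : Fin (d + 1) → ℂ) (hlam : ∀ c, lam c ≠ 0) (K : Finset (Fin N)) (hKT : K ⊆ T)
    (hK : ∀ t ∈ K, (i ∈ S t ∧ ∀ v : Fin (d + 1) → Fin (d + 1), ∑ c, lam c * u t (Function.update v i c) = 0) ∨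
      (i ∉ S t ∧ ∀ v : Fin (d + 1) → Fin (d + 1), ∑ c, lam c * w t (Function.update v i c) = 0)) :
    B ≤ ∑ t ∈ T \ K, wt (univ.filter (fun k : Fin d => i.succAbove k ∈ S t)).card := by
  classical
  -- the embedding with free letter `c`, and a base letter for the blind factor
  set E : Fin (d + 1) → (Fin d → Fin (d + 1)) → (Fin (d + 1) → Fin (d + 1)) := fun c v' => i.insertNth c v' with hE
  have hEi : ∀ c v', E c v' i = c := fun c v' => by simp [hE]
  have hEk : ∀ c v' k, E c v' (i.succAbove k) = v' k := fun c v' k => by simp [hE]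
  have hEupd : ∀ c c' v', Function.update (E c v') i c' = E c' v' := by
    intro c c' v'
    funext j
    rcases Fin.eq_self_or_eq_succAbove i j with rfl | ⟨k, rfl⟩
    · rw [Function.update_self, hEi]
    · rw [Function.update_of_ne (Fin.succAbove_ne _ _), hEk, hEk]
  -- agreement of two embeddings on / off the split
  have hEu : ∀ t c, ∀ v v' : Fin d → Fin (d + 1),
      (∀ k ∈ univ.filter (fun k : Fin d => i.succAbove k ∈ S t), v k = v' k) → u t (E c v) = u t (E c v') := by
    intro t c v v' hvv'
    refine hu t _ _ (fun j hj => ?_)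
    rcases Fin.eq_self_or_eq_succAbove i j with rfl | ⟨k, rfl⟩
    · rw [hEi, hEi]
    · have hk : k ∈ univ.filter (fun k : Fin d => i.succAbove k ∈ S t) := by simpa using hj
      rw [hEk, hEk, hvv' k hk]
  have hEw : ∀ t c, ∀ v v' : Fin d → Fin (d + 1),
      (∀ k, k ∉ univ.filter (fun k : Fin d => i.succAbove k ∈ S t) → v k = v' k) → w t (E c v) = w t (E c v') := by
    intro t c v v' hvv'
    refine hw t _ _ (fun j hj => ?_)
    rcases Fin.eq_self_or_eq_succAbove i j with rfl | ⟨k, rfl⟩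
    · rw [hEi, hEi]
    · have hk : k ∉ univ.filter (fun k : Fin d => i.succAbove k ∈ S t) := by simpa using hj
      rw [hEk, hEk, hvv' k hk]
  -- changing the free letter does not affect a factor blind to slot `i`
  have hwc : ∀ t c v, i ∈ S t → w t (E c v) = w t (E (0 : Fin (d + 1)) v) := by
    intro t c v hi
    refine hw t _ _ (fun j hj => ?_)
    have hji : j ≠ i := fun h => hj (h ▸ hi)
    rw [← hEupd 0 c v, Function.update_of_ne hji]
  have huc : ∀ t c v, i ∉ S t → u t (E c v) = u t (E (0 : Fin (d + 1)) v) := by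
    intro t c v hi
    refine hu t _ _ (fun j hj => ?_)
    have hji : j ≠ i := fun h => hi (h ▸ hj)
    rw [← hEupd 0 c v, Function.update_of_ne hji]
  -- the torus weights
  have hprod_ne : (∏ c, lam c) ≠ 0 := prod_ne_zero_iff.mpr fun c _ => hlam c
  set pS : Fin N → (Fin d → Fin (d + 1)) → ℂ :=
    fun t v => ∏ k ∈ univ.filter (fun k : Fin d => i.succAbove k ∈ S t), lam (v k) with hpS
  set pC : Fin N → (Fin d → Fin (d + 1)) → ℂ :=
    fun t v => ∏ k ∈ univ \ univ.filter (fun k : Fin d => i.succAbove k ∈ S t), lam (v k) with hpC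
  have hpSC : ∀ t v, pS t v * pC t v = ∏ k, lam (v k) := by
    intro t v
    simp only [hpS, hpC]
    rw [sdiff_eq_inter_compl, univ_inter, prod_mul_prod_compl]
  -- the contracted decomposition of the rectangular pattern
  refine hR N (T \ K) (fun t => univ.filter (fun k : Fin d => i.succAbove k ∈ S t))
    (fun t v => pS t v * (if i ∈ S t then ∑ c, lam c * u t (E c v) else u t (E 0 v)))
    (fun t v => (∏ c, lam c)⁻¹ * pC t v * (if i ∈ S t then w t (E 0 v) else ∑ c, lam c * w t (E c v))) ?_ ?_ ?_
  · -- `u'` locality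
    intro t v v' hvv'
    have hp : pS t v = pS t v' := by
      simp only [hpS]; exact prod_congr rfl fun k hk => by rw [hvv' k hk]
    rw [hp]
    congr 1
    by_cases hi : i ∈ S t
    · simp only [if_pos hi]
      exact sum_congr rfl fun c _ => by rw [hEu t c v v' hvv']
    · simp only [if_neg hi]; exact hEu t 0 v v' hvv'
  · -- `w'` locality
    intro t v v' hvv'
    have hp : pC t v = pC t v' := by
      simp only [hpC]
      refine prod_congr rfl fun k hk => ?_
      rw [hvv' k (mem_sdiff.mp hk).2]
    rw [hp]
    congr 1
    by_cases hi : i ∈ S t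
    · simp only [if_pos hi]; exact hEw t 0 v v' hvv'
    · simp only [if_neg hi]
      exact sum_congr rfl fun c _ => by rw [hEw t c v v' hvv']
  · -- the identity
    intro v
    -- each surviving term contracts to `(Π λ)⁻¹ (Π_k λ_{v k}) Σ_c λ_c u_t(E c v) w_t(E c v)`
    have hterm : ∀ t, (pS t v * (if i ∈ S t then ∑ c, lam c * u t (E c v) else u t (E 0 v))) *
        ((∏ c, lam c)⁻¹ * pC t v * (if i ∈ S t then w t (E 0 v) else ∑ c, lam c * w t (E c v))) =
        (∏ c, lam c)⁻¹ * (∏ k, lam (v k)) * ∑ c, lam c * (u t (E c v) * w t (E c v)) := by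
      intro t
      rw [← hpSC t v]
      by_cases hi : i ∈ S t
      · simp only [if_pos hi]
        have : (∑ c, lam c * u t (E c v)) * w t (E 0 v) = ∑ c, lam c * (u t (E c v) * w t (E c v)) := by
          rw [sum_mul]; exact sum_congr rfl fun c _ => by rw [hwc t c v hi]; ring
        rw [← this]; ring
      · simp only [if_neg hi]
        have : u t (E 0 v) * (∑ c, lam c * w t (E c v)) = ∑ c, lam c * (u t (E c v) * w t (E c v)) := by
          rw [mul_sum]; exact sum_congr rfl fun c _ => by rw [huc t c v hi]; ring
        rw [← this]; ring
    simp only [hterm]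
    rw [← mul_sum, sum_comm]
    -- the killed terms contribute nothing
    have hK0 : ∑ c, ∑ t ∈ K, lam c * (u t (E c v) * w t (E c v)) = 0 := by
      rw [sum_comm]
      refine sum_eq_zero fun t ht => ?_
      rcases hK t ht with ⟨hi, hz⟩ | ⟨hi, hz⟩
      · have : ∑ c, lam c * (u t (E c v) * w t (E c v)) = (∑ c, lam c * u t (E c v)) * w t (E 0 v) := by
          rw [sum_mul]; exact sum_congr rfl fun c _ => by rw [hwc t c v hi]; ring
        rw [this]
        have hz' := hz (E 0 v)
        simp only [hEupd] at hz'
        rw [hz', zero_mul]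
      · have : ∑ c, lam c * (u t (E c v) * w t (E c v)) = u t (E 0 v) * ∑ c, lam c * w t (E c v) := by
          rw [mul_sum]; exact sum_congr rfl fun c _ => by rw [huc t c v hi]; ring
        rw [this]
        have hz' := hz (E 0 v)
        simp only [hEupd] at hz'
        rw [hz', mul_zero]
    have htot : ∑ c, ∑ t ∈ T \ K, lam c * (u t (E c v) * w t (E c v)) =
        ∑ c, lam c * (if Function.Injective (E c v) then (1 : ℂ) else 0) := by
      have hkill : ∀ c, ∑ t ∈ T \ K, lam c * (u t (E c v) * w t (E c v)) =
          ∑ t ∈ T, lam c * (u t (E c v) * w t (E c v)) - ∑ t ∈ K, lam c * (u t (E c v) * w t (E c v)) := by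
        intro c
        rw [← sum_sdiff hKT]; ring
      simp only [hkill, sum_sub_distrib, hK0, sub_zero]
      refine sum_congr rfl fun c _ => ?_
      rw [← mul_sum, hsum]
    rw [htot]
    simp only [hE]
    rw [mul_assoc, sum_pattern_rect i lam v]
    by_cases hv : Function.Injective v
    · rw [if_pos hv, if_pos hv, inv_mul_cancel₀ hprod_ne]
    · rw [if_neg hv, if_neg hv, mul_zero]

/-! ### §3 `d + 1 = 5`: no idle slot from the pair half of LO(4,5) -/

/-- **No idle slot.**  Assume the PAIR half of LO(4,5) in weight form: every split-rank-one decomposition of the `4`-slot,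
`5`-letter injective pattern has `10 ≤ Σ_t wt |S_t|` with `wt 2 = 1` and `wt c = 10` otherwise («not a sum of nine `2|2`
terms»).  Then a slice-free split-rank-one decomposition of `P₅` of Laplace weight `< 120` (official format; all
`|S_t| ∈ {2,3}`) uses every slot `q` on the PAIR side of some term: `q ∈ S_t` with `|S_t| = 2`, or `q ∉ S_t` with
`|S_t| = 3`.  (Otherwise contract slot `q` against `𝟙`: all `≤ 9` terms become `2|2` terms of `P₄,₅`.) -/
theorem no_idle_slot_of_rect
    (hR : ∀ (N' : ℕ) (T' : Finset (Fin N')) (S' : Fin N' → Finset (Fin 4))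
      (u' w' : Fin N' → (Fin 4 → Fin 5) → ℂ),
      (∀ t, ∀ v v' : Fin 4 → Fin 5, (∀ k ∈ S' t, v k = v' k) → u' t v = u' t v') →
      (∀ t, ∀ v v' : Fin 4 → Fin 5, (∀ k, k ∉ S' t → v k = v' k) → w' t v = w' t v') →
      (∀ v : Fin 4 → Fin 5, (∑ t ∈ T', u' t v * w' t v) = if Function.Injective v then 1 else 0) →
      10 ≤ ∑ t ∈ T', (if (S' t).card = 2 then 1 else 10))
    {N : ℕ} (T : Finset (Fin N)) (S : Fin N → Finset (Fin 5)) (u w : Fin N → (Fin 5 → Fin 5) → ℂ)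
    (hu : ∀ t, ∀ v v' : Fin 5 → Fin 5, (∀ j ∈ S t, v j = v' j) → u t v = u t v')
    (hw : ∀ t, ∀ v v' : Fin 5 → Fin 5, (∀ j, j ∉ S t → v j = v' j) → w t v = w t v')
    (hsum : ∀ v : Fin 5 → Fin 5, (∑ t ∈ T, u t v * w t v) = if Function.Injective v then 1 else 0)
    (hcheap : ∑ t ∈ T, (S t).card.factorial * (5 - (S t).card).factorial < Nat.factorial 5)
    (hpairs : ∀ t ∈ T, (S t).card = 2 ∨ (S t).card = 3) (q : Fin 5) :
    ∃ t ∈ T, (q ∈ S t ∧ (S t).card = 2) ∨ (q ∉ S t ∧ (S t).card = 3) := by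
  classical
  by_contra hidle
  push Not at hidle
  -- contract slot `q` against the all-ones covector; nothing is killed
  have hb := contract_rect (d := 4) (fun c => if c = 2 then 1 else 10) 10 hR T S u w hu hw hsum q (fun _ => 1)
    (fun _ => one_ne_zero) ∅ (empty_subset _) (fun t ht => absurd ht (notMem_empty t))
  rw [sdiff_empty] at hb
  -- every term has `q` on its `3`-side, so it contracts to a `2|2` term
  have hc : ∀ t ∈ T, (univ.filter (fun k : Fin 4 => q.succAbove k ∈ S t)).card = 2 := by
    intro t ht
    have h := LaplaceRestrict.card_eq q (S t)
    rcases hpairs t ht with h2 | h3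
    · have hq : q ∉ S t := fun hq => (hidle t ht).1 hq h2
      rw [if_neg hq, h2] at h; omega
    · have hq : q ∈ S t := by
        by_contra hq; exact (hidle t ht).2 hq h3
      rw [if_pos hq, h3] at h; omega
  have hsum1 : ∑ t ∈ T, (if (univ.filter (fun k : Fin 4 => q.succAbove k ∈ S t)).card = 2 then 1 else 10) = T.card := by
    rw [card_eq_sum_ones]
    exact sum_congr rfl fun t ht => by rw [if_pos (hc t ht)]
  rw [hsum1] at hb
  -- but each term weighs `12`, and the total weight is `< 120`
  have h12 : ∀ t ∈ T, (S t).card.factorial * (5 - (S t).card).factorial = 12 := by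
    intro t ht
    rcases hpairs t ht with h | h <;> rw [h] <;> decide
  have hwt : ∑ t ∈ T, (S t).card.factorial * (5 - (S t).card).factorial = 12 * T.card := by
    rw [sum_congr rfl h12, sum_const, smul_eq_mul, mul_comm]
  rw [hwt, show Nat.factorial 5 = 120 from rfl] at hcheap
  omega

end LaplaceContractRect

end Summit.ValiantsHypothesis.ValiantsHypothesis.Theorems.RigidityForcesSymmetryRankRigidMinimalRepr
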